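/-
Width seat `ym-line-sgb-p1-w2` (gen 2, seat prover-ym-line-sgb-p1-w2-g2-0), route `SteinGapBootstrap`, support item
`USteinTransferPair` (stmt-QuantumFields-23799, U's child = alias of `SteinTransferPairG`): the route decl, BY NAME.
-/
import Summits.QuantumFields.YangMills.Theorems.SteinGapBootstrapSteinTransferPairG
import HarnessLib

/-!
# Route `SteinGapBootstrap`, support item `USteinTransferPair` (stmt-QuantumFields-23799) — PROVED

NOT THE CLAY GAP: the route bears on the RECORD-label rung leaf `WeakCouplingRates.XiPow`; this item is Gaussian analysis only.

`USteinTransferPair` is, by definition, the decl `SteinTransferPairG` (stmt-QuantumFields-23639; the unconditional rate line U reuses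
K1's child): Stein's lemma for the lattice-Maxwell pair-block law.  It closes by the landed `SteinTransferPairG_proof`
(`steinTransferPairG_of_steinEquation` + the discharged Stein equation `Meckes2009_lemma1_steinEquation_latticeMaxwellBlock_holds`).

References: E. Meckes, IMS Collections 5 (2009) 153–178, arXiv:0902.0333, Lemmas 1–2 [Meckes2009]; Chen–Goldstein–Shao, *Normal
approximation by Stein's method* (2011), Ch. 2 [doi:10.1214/09-AOP467 for the exchangeable-pairs context].
-/

set_option autoImplicit false

namespace Summit.QuantumFields.YangMills.Theorems.SteinGapBootstrap

/-- **The support item `USteinTransferPair` of route `SteinGapBootstrap` (stmt-QuantumFields-23799), by name**: the alias of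
`SteinTransferPairG`, closed by `SteinTransferPairG_proof`.  NOT THE CLAY GAP. -/
theorem USteinTransferPair_proof : Summit.QuantumFields.YangMills.Theses.SteinGapBootstrap.USteinTransferPair := by
  unfold Summit.QuantumFields.YangMills.Theses.SteinGapBootstrap.USteinTransferPair
  exact SteinTransferPairG_proof

end Summit.QuantumFields.YangMills.Theorems.SteinGapBootstrap
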